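import Summits.Ventures.PercRepro.PerFlatTransfer
import Summits.Ventures.PercRepro.SevenThreeP2
import Summits.Ventures.PercRepro.SevenThreeFrame

/-!
# PercRepro — the `(7,3)` cell: the per-plane inequality on the `t = 0` planes, modulo Theorem P₁(7,3) (p3, gen 15)

On a matroid of rank `7`, a plane `G` with `ρ(E ∖ G) = 7` (type `t = 0`) has every rank-`3` subset `B ⊆ G` in `U_G`, and
the witnesses `S` with `S ∩ G = B` for distinct `B` are disjoint, so `supply(G) ≥ Σ_{B ∈ U_G} s(B)`. For `|B| ≥ 4`,
Theorem P₂(7,3) (`SevenThreeP2.lean`) gives `s(B) ≥ 28/5` from an independent `7`-set `W ⊆ E ∖ G` (which spans rank `7`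
with `B`); for `|B| = 3` the per-triple lemma P₁(7,3) is taken as the hypothesis `hP₁` (mine-2 §27, the lane's open piece):
for every triple `T ∈ U_G` and every independent `7`-set `W ⊆ E ∖ G`, the witnesses `T ∪ X`, `X ⊆ W`, supply `≥ 28/5`.
`perPlane_of_seven` is the `(7,3)` twin of p2's `SixThreePlane.perPlane_of_six_le`, and `rls_seven_three_of_P1` composes it with
the global frame: `ThmN.RLS M 7 3` for a simple matroid of rank `7` follows from P₁(7,3) (`hP₁`, all planes) and the per-plane
inequality on the planes of positive type `ρ(E ∖ G) ≤ 6` (`hpos`; on the core these are the ≤ `6`-point planes, plan §8).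
(`P3-C025-seven-three-plan.md` §9 (R5).)
-/

namespace PercRepro

namespace SevenThree

open Finset ThmH SixThree PerFlat

variable {α : Type*} [DecidableEq α] {M : Matroid α} [M.Finite]

omit [DecidableEq α] in
/-- Membership in `Yq M 7 3`: subsets of the ground set of rank `4`, `5` or `6`. -/
theorem mem_Yq_seven_three {S : Finset α} :
    S ∈ Yq M 7 3 ↔ S ⊆ gr M ∧ (3 : ℕ∞) < M.eRk (S : Set α) ∧ M.eRk (S : Set α) < 7 := by
  unfold Yq
  rw [Finset.mem_filter, Finset.mem_powerset]
  rfl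

/-- Membership in `UqG M 7 3 G`. -/
theorem mem_UqG_seven_three {G B : Finset α} :
    B ∈ UqG M 7 3 G ↔ (B ⊆ gr M ∧ M.eRk (B : Set α) = 3 ∧ M.eRk ((gr M \ B : Finset α) : Set α) = 7) ∧ B ⊆ G := by
  unfold UqG
  rw [Finset.mem_filter, mem_Uq]
  rfl

/-- The supply of `G` is at least the sum over `B ∈ U_G` of the supplies of the witness families `{S : S ∩ G = B}`. -/
theorem sum_UqG_le_supply_seven (G : Finset α) :
    ∑ B ∈ UqG M 7 3 G, ∑ S ∈ (Yq M 7 3).filter (fun S => S ∩ G = B), fRule M G S / D M S ≤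
      ∑ S ∈ Yq M 7 3, fRule M G S / D M S := by
  classical
  have hmaps : ∀ S ∈ Yq M 7 3, S ∩ G ∈ G.powerset := by
    intro S _
    rw [Finset.mem_powerset]
    exact Finset.inter_subset_right
  rw [← Finset.sum_fiberwise_of_maps_to hmaps]
  apply Finset.sum_le_sum_of_subset_of_nonneg
  · intro B hB
    rw [Finset.mem_powerset]
    exact (mem_UqG_seven_three.1 hB).2
  · intro B _ _
    apply Finset.sum_nonneg
    intro S _
    exact div_nonneg (fRule_nonneg M G S) (D_nonneg M S)

/-- A `7`-element independent subset of `E ∖ G` when `ρ(E ∖ G) ≥ 7`. -/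
theorem exists_indep_seven {G : Finset α} (hr7 : (7 : ℕ∞) ≤ M.eRk ((gr M \ G : Finset α) : Set α)) :
    ∃ W : Finset α, W ⊆ gr M \ G ∧ M.Indep (W : Set α) ∧ W.card = 7 := by
  classical
  have hsub : ((gr M \ G : Finset α) : Set α) ⊆ M.E := by
    rw [← coe_gr M]; exact_mod_cast (Finset.sdiff_subset : gr M \ G ⊆ gr M)
  obtain ⟨I, hI⟩ := M.exists_isBasis ((gr M \ G : Finset α) : Set α) hsub
  have hIfin : I.Finite := (gr M \ G).finite_toSet.subset hI.subset
  have hIcard : 7 ≤ hIfin.toFinset.card := by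
    have h := hI.encard_eq_eRk
    have h' : I.encard = (hIfin.toFinset.card : ℕ∞) := Set.Finite.encard_eq_coe_toFinset_card hIfin
    have : (7 : ℕ∞) ≤ (hIfin.toFinset.card : ℕ∞) := by rw [← h', h]; exact hr7
    exact_mod_cast this
  obtain ⟨W, hWI, hW7⟩ := Finset.exists_subset_card_eq hIcard
  refine ⟨W, ?_, ?_, hW7⟩
  · intro y hy
    have := hWI hy
    rw [Set.Finite.mem_toFinset] at this
    exact_mod_cast hI.subset this
  · apply hI.indep.subset
    intro y hy
    have : y ∈ hIfin.toFinset := hWI (by exact_mod_cast hy)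
    rwa [Set.Finite.mem_toFinset] at this

/-- **The per-plane inequality on the `t = 0` planes, modulo Theorem P₁(7,3).** Let `M` be simple of rank `7`, `G` a
plane with `ρ(E ∖ G) = 7`, and assume P₁(7,3) in the primal form `hP₁` (every triple `T ∈ U_G` and every independent
`7`-set `W ⊆ E ∖ G`: the witnesses `S` with `S ∩ G = T`, `S ∖ G ⊆ W` supply `≥ 28/5`). Then
`(28/5)·#U_G ≤ Σ_{S ∈ Y(7,3)} f(G, S)/D(S)`. -/
theorem perPlane_of_seven (hs : Simple M) (hrank : M.eRank = 7) {G : Finset α} (hG : G ∈ planes M)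
    (hr7 : (7 : ℕ∞) ≤ M.eRk ((gr M \ G : Finset α) : Set α))
    (hP₁ : ∀ T ∈ UqG M 7 3 G, T.card = 3 → ∀ W ⊆ gr M \ G, M.Indep (W : Set α) → W.card = 7 →
      (28 / 5 : ℚ) ≤ ∑ S ∈ (Yq M 7 3).filter (fun S => S ∩ G = T ∧ S \ G ⊆ W), fRule M G S / D M S) :
    (28 / 5 : ℚ) * ((UqG M 7 3 G).card : ℚ) ≤ ∑ S ∈ Yq M 7 3, fRule M G S / D M S := by
  classical
  obtain ⟨W, hWsub, hWind, hW7⟩ := exists_indep_seven hr7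
  have hWg : W ⊆ gr M := hWsub.trans Finset.sdiff_subset
  have hWG : Disjoint W G := Finset.disjoint_of_subset_left hWsub Finset.sdiff_disjoint
  have hY : ∀ S, S ⊆ gr M → (3 : ℕ∞) < M.eRk (S : Set α) → M.eRk (S : Set α) < 7 → S ∈ Yq M 7 3 :=
    fun S h1 h2 h3 => mem_Yq_seven_three.2 ⟨h1, h2, h3⟩
  calc (28 / 5 : ℚ) * ((UqG M 7 3 G).card : ℚ) = ∑ _B ∈ UqG M 7 3 G, (28 / 5 : ℚ) := by
        rw [Finset.sum_const, nsmul_eq_mul, mul_comm]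
    _ ≤ ∑ B ∈ UqG M 7 3 G, ∑ S ∈ (Yq M 7 3).filter (fun S => S ∩ G = B), fRule M G S / D M S := by
        apply Finset.sum_le_sum
        intro B hB
        obtain ⟨⟨hBg, hrB, -⟩, hBG⟩ := mem_UqG_seven_three.1 hB
        have hb3 : 3 ≤ B.card := three_le_card_of_eRk_eq_three hrB
        rcases Nat.eq_or_lt_of_le hb3 with h3 | h4
        · -- a triple: restrict the witnesses to `W`, then P₁(7,3)
          calc (28 / 5 : ℚ) ≤ ∑ S ∈ (Yq M 7 3).filter (fun S => S ∩ G = B ∧ S \ G ⊆ W), fRule M G S / D M S :=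
                hP₁ B hB h3.symm W hWsub hWind hW7
            _ ≤ _ := by
                apply Finset.sum_le_sum_of_subset_of_nonneg
                · intro S hS
                  rw [Finset.mem_filter] at hS ⊢
                  exact ⟨hS.1, hS.2.1⟩
                · intro S _ _
                  exact div_nonneg (fRule_nonneg M G S) (D_nonneg M S)
        · -- `|B| ≥ 4`: Theorem P₂(7,3) with `ρ(B ∪ W) = 7` (`W` is independent of size `7` in a matroid of rank `7`)
          have hBW : M.eRk ((B ∪ W : Finset α) : Set α) = 7 := by
            apply le_antisymm
            · rw [← hrank]; exact M.eRk_le_eRank _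
            · calc (7 : ℕ∞) = M.eRk (W : Set α) := by
                    rw [hWind.eRk_eq_encard, Set.encard_coe_eq_coe_finsetCard, hW7]; rfl
                _ ≤ M.eRk ((B ∪ W : Finset α) : Set α) :=
                    M.eRk_mono (Finset.coe_subset.2 Finset.subset_union_right)
          exact supply_ge_phi_of_four_le hs hG hBG hrB h4 hWg hWG hW7 hBW (Yq M 7 3) hY
    _ ≤ ∑ S ∈ Yq M 7 3, fRule M G S / D M S := sum_UqG_le_supply_seven G

/-- **Composition**: for a simple matroid of rank `7`, `ThmN.RLS M 7 3` follows from P₁(7,3) on every plane (`hP₁`) and the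
per-plane inequality on the planes of positive type (`hpos`: `ρ(E ∖ G) ≤ 6`). -/
theorem rls_seven_three_of_P1 {α : Type} [DecidableEq α] {M : Matroid α} [M.Finite] (hs : Simple M)
    (hrank : M.eRank = 7)
    (hP₁ : ∀ G ∈ planes M, ∀ T ∈ UqG M 7 3 G, T.card = 3 → ∀ W ⊆ gr M \ G, M.Indep (W : Set α) → W.card = 7 →
      (28 / 5 : ℚ) ≤ ∑ S ∈ (Yq M 7 3).filter (fun S => S ∩ G = T ∧ S \ G ⊆ W), fRule M G S / D M S)
    (hpos : ∀ G ∈ planes M, M.eRk ((gr M \ G : Finset α) : Set α) < 7 →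
      (28 / 5 : ℚ) * ((UqG M 7 3 G).card : ℚ) ≤ ∑ S ∈ Yq M 7 3, fRule M G S / D M S) :
    ThmN.RLS M 7 3 := by
  apply rls_seven_three_of_perPlane M
  intro G hG
  by_cases h7 : (7 : ℕ∞) ≤ M.eRk ((gr M \ G : Finset α) : Set α)
  · exact perPlane_of_seven hs hrank hG h7 (hP₁ G hG)
  · exact hpos G hG (lt_of_not_ge h7)

end SevenThree

end PercRepro
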